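import Mathlib
import Summits.ValiantsHypothesis.ValiantsHypothesis.Theorems.RigidityForcesSymmetryRankRigidMinimalReprLaplaceFiveThreeSplitCrossSwap

/-!
# Young-shadow COHERENCE on slack supports: the EXCHANGE lemma; star and triangle-plus-edge
# (crux `RankRigidMinimalRepr`, stmt-ValiantsHypothesis-18034; frontier rung `LaplaceOptimalFive`, stmt-24813; line `shallow_collision`
#  rev 4′, stub S2′ `stub_sideSym_offShell_five` = young-shadow K1 on SLACK supports; sequel of `…FourSplitSlack`, R286 (1)(ii))

On the slack four-split supports separation fails (`…FourSplitSlack.not_fourSplit_separation_star / _triangleEdge`), but the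
slack is ONE multiplicity vector shared by all shadows: the shadows are CONJUGATE to each other modulo fully symmetric tensors.
The engine is the elementary EXCHANGE lemma (the trick behind `triangle_concrete` of the held three-split file and behind
`full_of_two_stabilizers`):

* `exchange` — if a slot permutation `τ` carries the pair split `S₁` onto `S₂ ≠ S₁` and `S₂` onto `S₁`, `Z_k` is symmetric within
  both sides of `S_k`, `R` is `τ`-invariant and `Z₁ + Z₂ + R` is fully symmetric, then `Z₂ − τ•Z₁` (`= τ•Z₂ − Z₁`) is FULLY
  symmetric — it is symmetric within both sides of `S₂` and of `S₁`;
* `star_coherence` — on the star `{pa, pb, pc, pd}`: `Z_{pb} − (a b)•Z_{pa}`, `Z_{pc} − (a c)•Z_{pa}`, `Z_{pd} − (a d)•Z_{pa}` are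
  fully symmetric, hence so is `Z_{pa} + (a b)•Z_{pa} + (a c)•Z_{pa} + (a d)•Z_{pa}` («the vertex sums of the edge function are
  constant»: the `(4,1)`-part of every shadow vanishes and the `(3,2)`-parts are the conjugates of ONE vector — exactly the
  `5 / 175`-dimensional slack of the census);
* `triangleEdge_coherence` — on `{pa, pb, ab, cd}`: `Z_{pb} − (a b)•Z_{pa}` and `Z_{ab} − (p b)•Z_{pa}` are fully symmetric (the
  three triangle shadows are conjugate modulo symmetric tensors; the disjoint edge `cd` carries the weights `2 / −1` of the two
  relations and is not a conjugate);
* `cycle_antipodal_coherence` — on `C₄ = {01,12,23,30}`: `Z₃ − ((0 3)(1 2))•Z₁` and `Z₄ − ((0 1)(2 3))•Z₂` are fully symmetric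
  (opposite edges conjugate; the adjacent sign relation is not claimed).

HONEST FRAMING: structure lemmas for S2′ on slack supports; `LaplaceOptimalFive` (stmt-24813) stays OPEN · CONTESTED 72/120; nothing
here bears on `VP ≠ VNP`, which is NOT proved.
-/

set_option autoImplicit false

-- the mandated summit-side namespace repeats a component by design (single-problem summit)
set_option linter.dupNamespace false

namespace Summit.ValiantsHypothesis.ValiantsHypothesis.Theorems.RigidityForcesSymmetryRankRigidMinimalRepr

namespace LaplaceFiveSectorSplit

open Finset

/-! ### §1 Shifts along a slot permutation -/

/-- Side-symmetry on `A` of `T` becomes side-symmetry on `σ(A)` of the shifted tensor `v ↦ T (v ∘ σ)`. -/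
theorem slotInvariantOn_comp {A : Finset (Fin 5)} {T : (Fin 5 → Fin 5) → ℂ} (σ : Equiv.Perm (Fin 5))
    (h : SlotInvariantOn A T) : SlotInvariantOn (A.image ⇑σ) (fun v => T (v ∘ ⇑σ)) := by
  intro τ hτ v
  have key : (v ∘ ⇑τ) ∘ ⇑σ = (v ∘ ⇑σ) ∘ ⇑(σ⁻¹ * τ * σ) := by
    funext i; simp
  show T ((v ∘ ⇑τ) ∘ ⇑σ) = T (v ∘ ⇑σ)
  rw [key]
  apply h (σ⁻¹ * τ * σ)
  intro i hi
  have hni : σ i ∉ A.image ⇑σ := fun hm => by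
    obtain ⟨j, hj, hji⟩ := Finset.mem_image.1 hm
    exact hi (σ.injective hji ▸ hj)
  simp [hτ _ hni]

/-- The image of a complement under a slot permutation is the complement of the image. -/
theorem image_compl_perm' (σ : Equiv.Perm (Fin 5)) (A : Finset (Fin 5)) : (Aᶜ).image ⇑σ = (A.image ⇑σ)ᶜ := by
  ext x
  simp only [Finset.mem_image, Finset.mem_compl]
  constructor
  · rintro ⟨y, hy, rfl⟩ ⟨z, hz, hzy⟩
    exact hy (σ.injective hzy ▸ hz)
  · intro hx
    exact ⟨σ.symm x, fun h => hx ⟨_, h, σ.apply_symm_apply x⟩, σ.apply_symm_apply x⟩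

/-- Side-symmetry for a split is transported to side-symmetry for its image. -/
theorem sideSym_comp {A B : Finset (Fin 5)} {T : (Fin 5 → Fin 5) → ℂ} (σ : Equiv.Perm (Fin 5)) (hAB : A.image ⇑σ = B)
    (h : SlotInvariantOn A T ∧ SlotInvariantOn Aᶜ T) :
    SlotInvariantOn B (fun v => T (v ∘ ⇑σ)) ∧ SlotInvariantOn Bᶜ (fun v => T (v ∘ ⇑σ)) := by
  refine ⟨?_, ?_⟩
  · have h1 := slotInvariantOn_comp σ h.1; rwa [hAB] at h1
  · have h2 := slotInvariantOn_comp σ h.2; rwa [image_compl_perm', hAB] at h2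

/-! ### §2 The exchange lemma -/

/-- **EXCHANGE LEMMA.**  Let `τ` carry the pair split `S₁` onto `S₂` and `S₂` onto `S₁` (`S₁ ≠ S₂`), let `Z_k` be symmetric within
both sides of `S_k`, let `R` be `τ`-invariant and `Z₁ + Z₂ + R` fully slot-symmetric.  Then `Z₂ − τ•Z₁` is fully slot-symmetric
(and equals `τ•Z₂ − Z₁`). -/
theorem exchange {S₁ S₂ : Finset (Fin 5)} (h₁ : S₁.card = 2) (h₂ : S₂.card = 2) (h12 : S₁ ≠ S₂) (τ : Equiv.Perm (Fin 5))
    (hτ₁ : S₁.image ⇑τ = S₂) (hτ₂ : S₂.image ⇑τ = S₁) {Z₁ Z₂ R : (Fin 5 → Fin 5) → ℂ}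
    (hZ₁ : SlotInvariantOn S₁ Z₁ ∧ SlotInvariantOn S₁ᶜ Z₁) (hZ₂ : SlotInvariantOn S₂ Z₂ ∧ SlotInvariantOn S₂ᶜ Z₂)
    (hR : InvUnder τ R) (hsum : SlotInvariantOn Finset.univ (Z₁ + Z₂ + R)) :
    SlotInvariantOn Finset.univ (Z₂ - fun v => Z₁ (v ∘ ⇑τ)) := by
  -- the exchange identity: Z₂ - τ•Z₁ = τ•Z₂ - Z₁
  have hid : (Z₂ - fun v => Z₁ (v ∘ ⇑τ)) = (fun v => Z₂ (v ∘ ⇑τ)) - Z₁ := by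
    funext v
    have h := invUnder_of_univ hsum τ v
    have hr := hR v
    simp only [Pi.add_apply, Pi.sub_apply] at h ⊢
    linear_combination hr - h
  refine full_of_two_stabilizers S₂ S₁ h₂ h₁ (Ne.symm h12)
    ⟨slotInvariantOn_sub hZ₂.1 (sideSym_comp τ hτ₁ hZ₁).1, slotInvariantOn_sub hZ₂.2 (sideSym_comp τ hτ₁ hZ₁).2⟩ ?_
  rw [hid]
  exact ⟨slotInvariantOn_sub (sideSym_comp τ hτ₂ hZ₂).1 hZ₁.1, slotInvariantOn_sub (sideSym_comp τ hτ₂ hZ₂).2 hZ₁.2⟩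

/-- The image of a pair `{p, a}` under the transposition `(a b)` (with `p ∉ {a, b}`) is `{p, b}`. -/
theorem image_pair_swap (p a b : Fin 5) (hpa : p ≠ a) (hpb : p ≠ b) :
    ({p, a} : Finset (Fin 5)).image ⇑(Equiv.swap a b) = {p, b} := by
  rw [Finset.image_insert, Finset.image_singleton, Equiv.swap_apply_of_ne_of_ne hpa hpb, Equiv.swap_apply_left]

/-! ### §3 Coherence on the star -/

/-- **STAR COHERENCE.**  On the star `{pa, pb, pc, pd}` (slots pairwise distinct), shadows `Z_k` symmetric within both sides of their
split with fully symmetric sum are CONJUGATE modulo fully symmetric tensors — `Z_{pb} − (a b)•Z_{pa}`, `Z_{pc} − (a c)•Z_{pa}`,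
`Z_{pd} − (a d)•Z_{pa}` are fully symmetric — and consequently `Z_{pa} + (a b)•Z_{pa} + (a c)•Z_{pa} + (a d)•Z_{pa}` is fully
symmetric (its `(4,1)`-part vanishes: the slack is one vector of type `(3,2)`). -/
theorem star_coherence (p a b c d : Fin 5) (hpa : p ≠ a) (hpb : p ≠ b) (hpc : p ≠ c) (hpd : p ≠ d) (hab : a ≠ b)
    (hac : a ≠ c) (had : a ≠ d) (hbc : b ≠ c) (hbd : b ≠ d) (hcd : c ≠ d) (Z₁ Z₂ Z₃ Z₄ : (Fin 5 → Fin 5) → ℂ)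
    (hZ₁ : SlotInvariantOn ({p, a} : Finset (Fin 5)) Z₁ ∧ SlotInvariantOn ({p, a} : Finset (Fin 5))ᶜ Z₁)
    (hZ₂ : SlotInvariantOn ({p, b} : Finset (Fin 5)) Z₂ ∧ SlotInvariantOn ({p, b} : Finset (Fin 5))ᶜ Z₂)
    (hZ₃ : SlotInvariantOn ({p, c} : Finset (Fin 5)) Z₃ ∧ SlotInvariantOn ({p, c} : Finset (Fin 5))ᶜ Z₃)
    (hZ₄ : SlotInvariantOn ({p, d} : Finset (Fin 5)) Z₄ ∧ SlotInvariantOn ({p, d} : Finset (Fin 5))ᶜ Z₄)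
    (hsum : SlotInvariantOn Finset.univ (Z₁ + Z₂ + Z₃ + Z₄)) :
    SlotInvariantOn Finset.univ (Z₂ - fun v => Z₁ (v ∘ ⇑(Equiv.swap a b))) ∧
    SlotInvariantOn Finset.univ (Z₃ - fun v => Z₁ (v ∘ ⇑(Equiv.swap a c))) ∧
    SlotInvariantOn Finset.univ (Z₄ - fun v => Z₁ (v ∘ ⇑(Equiv.swap a d))) ∧
    SlotInvariantOn Finset.univ (Z₁ + (fun v => Z₁ (v ∘ ⇑(Equiv.swap a b))) + (fun v => Z₁ (v ∘ ⇑(Equiv.swap a c))) +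
      fun v => Z₁ (v ∘ ⇑(Equiv.swap a d))) := by
  have c₁ : ({p, a} : Finset (Fin 5)).card = 2 := Finset.card_pair hpa
  have c₂ : ({p, b} : Finset (Fin 5)).card = 2 := Finset.card_pair hpb
  have c₃ : ({p, c} : Finset (Fin 5)).card = 2 := Finset.card_pair hpc
  have c₄ : ({p, d} : Finset (Fin 5)).card = 2 := Finset.card_pair hpd
  -- distinctness of the splits
  have ne : ∀ x y : Fin 5, x ≠ y → p ≠ y → ({p, x} : Finset (Fin 5)) ≠ {p, y} := by
    intro x y hxy hpy h
    have hy : y ∈ ({p, x} : Finset (Fin 5)) := by rw [h]; simp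
    simp only [Finset.mem_insert, Finset.mem_singleton] at hy
    rcases hy with hy | hy
    · exact hpy hy.symm
    · exact hxy hy.symm
  -- memberships used for the `τ`-invariance of the untouched shadows
  have outside : ∀ (x y z : Fin 5) (Z : (Fin 5 → Fin 5) → ℂ), x ≠ p → x ≠ z → y ≠ p → y ≠ z →
      (SlotInvariantOn ({p, z} : Finset (Fin 5)) Z ∧ SlotInvariantOn ({p, z} : Finset (Fin 5))ᶜ Z) →
      InvUnder (Equiv.swap x y) Z := by
    intro x y z Z hxp hxz hyp hyz hZ
    refine invUnder_swap_of_not_mem hZ.2 ?_ ?_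
    · simp [hxp, hxz]
    · simp [hyp, hyz]
  -- Z₂ - (ab)•Z₁
  have D₂ : SlotInvariantOn Finset.univ (Z₂ - fun v => Z₁ (v ∘ ⇑(Equiv.swap a b))) := by
    have hR : InvUnder (Equiv.swap a b) (Z₃ + Z₄) :=
      invUnder_add (outside a b c Z₃ hpa.symm hac hpb.symm hbc hZ₃) (outside a b d Z₄ hpa.symm had hpb.symm hbd hZ₄)
    have hs : SlotInvariantOn Finset.univ (Z₁ + Z₂ + (Z₃ + Z₄)) := by
      have e : Z₁ + Z₂ + (Z₃ + Z₄) = Z₁ + Z₂ + Z₃ + Z₄ := by abel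
      rw [e]; exact hsum
    exact exchange c₁ c₂ (ne a b hab hpb) (Equiv.swap a b) (image_pair_swap p a b hpa hpb)
      (by rw [Equiv.swap_comm]; exact image_pair_swap p b a hpb hpa) hZ₁ hZ₂ hR hs
  -- Z₃ - (ac)•Z₁
  have D₃ : SlotInvariantOn Finset.univ (Z₃ - fun v => Z₁ (v ∘ ⇑(Equiv.swap a c))) := by
    have hR : InvUnder (Equiv.swap a c) (Z₂ + Z₄) :=
      invUnder_add (outside a c b Z₂ hpa.symm hab hpc.symm (Ne.symm hbc) hZ₂) (outside a c d Z₄ hpa.symm had hpc.symm hcd hZ₄)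
    have hs : SlotInvariantOn Finset.univ (Z₁ + Z₃ + (Z₂ + Z₄)) := by
      have e : Z₁ + Z₃ + (Z₂ + Z₄) = Z₁ + Z₂ + Z₃ + Z₄ := by abel
      rw [e]; exact hsum
    exact exchange c₁ c₃ (ne a c hac hpc) (Equiv.swap a c) (image_pair_swap p a c hpa hpc)
      (by rw [Equiv.swap_comm]; exact image_pair_swap p c a hpc hpa) hZ₁ hZ₃ hR hs
  -- Z₄ - (ad)•Z₁
  have D₄ : SlotInvariantOn Finset.univ (Z₄ - fun v => Z₁ (v ∘ ⇑(Equiv.swap a d))) := by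
    have hR : InvUnder (Equiv.swap a d) (Z₂ + Z₃) :=
      invUnder_add (outside a d b Z₂ hpa.symm hab hpd.symm (Ne.symm hbd) hZ₂)
        (outside a d c Z₃ hpa.symm hac hpd.symm (Ne.symm hcd) hZ₃)
    have hs : SlotInvariantOn Finset.univ (Z₁ + Z₄ + (Z₂ + Z₃)) := by
      have e : Z₁ + Z₄ + (Z₂ + Z₃) = Z₁ + Z₂ + Z₃ + Z₄ := by abel
      rw [e]; exact hsum
    exact exchange c₁ c₄ (ne a d had hpd) (Equiv.swap a d) (image_pair_swap p a d hpa hpd)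
      (by rw [Equiv.swap_comm]; exact image_pair_swap p d a hpd hpa) hZ₁ hZ₄ hR hs
  refine ⟨D₂, D₃, D₄, ?_⟩
  have e : (Z₁ + (fun v => Z₁ (v ∘ ⇑(Equiv.swap a b))) + (fun v => Z₁ (v ∘ ⇑(Equiv.swap a c))) +
      fun v => Z₁ (v ∘ ⇑(Equiv.swap a d))) =
      (Z₁ + Z₂ + Z₃ + Z₄) - (Z₂ - fun v => Z₁ (v ∘ ⇑(Equiv.swap a b))) - (Z₃ - fun v => Z₁ (v ∘ ⇑(Equiv.swap a c))) -
        (Z₄ - fun v => Z₁ (v ∘ ⇑(Equiv.swap a d))) := by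
    funext v; simp only [Pi.add_apply, Pi.sub_apply]; ring
  rw [e]
  exact slotInvariantOn_sub (slotInvariantOn_sub (slotInvariantOn_sub hsum D₂) D₃) D₄

/-! ### §4 Coherence on the triangle plus a disjoint edge -/

/-- **TRIANGLE-EDGE COHERENCE.**  On `{pa, pb, ab, cd}` (slots `p, a, b` distinct and outside `{c, d}`) the three triangle shadows are
conjugate modulo fully symmetric tensors: `Z_{pb} − (a b)•Z_{pa}` and `Z_{ab} − (p b)•Z_{pa}` are fully symmetric. -/
theorem triangleEdge_coherence (p a b c d : Fin 5) (hpa : p ≠ a) (hpb : p ≠ b) (hpc : p ≠ c) (hpd : p ≠ d) (hab : a ≠ b)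
    (hac : a ≠ c) (had : a ≠ d) (hbc : b ≠ c) (hbd : b ≠ d) (Z₁ Z₂ Z₃ Z₄ : (Fin 5 → Fin 5) → ℂ)
    (hZ₁ : SlotInvariantOn ({p, a} : Finset (Fin 5)) Z₁ ∧ SlotInvariantOn ({p, a} : Finset (Fin 5))ᶜ Z₁)
    (hZ₂ : SlotInvariantOn ({p, b} : Finset (Fin 5)) Z₂ ∧ SlotInvariantOn ({p, b} : Finset (Fin 5))ᶜ Z₂)
    (hZ₃ : SlotInvariantOn ({a, b} : Finset (Fin 5)) Z₃ ∧ SlotInvariantOn ({a, b} : Finset (Fin 5))ᶜ Z₃)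
    (hZ₄ : SlotInvariantOn ({c, d} : Finset (Fin 5)) Z₄ ∧ SlotInvariantOn ({c, d} : Finset (Fin 5))ᶜ Z₄)
    (hsum : SlotInvariantOn Finset.univ (Z₁ + Z₂ + Z₃ + Z₄)) :
    SlotInvariantOn Finset.univ (Z₂ - fun v => Z₁ (v ∘ ⇑(Equiv.swap a b))) ∧
    SlotInvariantOn Finset.univ (Z₃ - fun v => Z₁ (v ∘ ⇑(Equiv.swap p b))) := by
  have c₁ : ({p, a} : Finset (Fin 5)).card = 2 := Finset.card_pair hpa
  have c₂ : ({p, b} : Finset (Fin 5)).card = 2 := Finset.card_pair hpb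
  have c₃ : ({a, b} : Finset (Fin 5)).card = 2 := Finset.card_pair hab
  have n12 : ({p, a} : Finset (Fin 5)) ≠ {p, b} := by
    intro h
    have ha : a ∈ ({p, b} : Finset (Fin 5)) := by rw [← h]; simp
    simp only [Finset.mem_insert, Finset.mem_singleton] at ha
    rcases ha with ha | ha
    · exact hpa ha.symm
    · exact hab ha
  have n13 : ({p, a} : Finset (Fin 5)) ≠ {a, b} := by
    intro h
    have hp : p ∈ ({a, b} : Finset (Fin 5)) := by rw [← h]; simp
    simp only [Finset.mem_insert, Finset.mem_singleton] at hp
    rcases hp with hp | hp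
    · exact hpa hp
    · exact hpb hp
  constructor
  · -- τ = (a b): swaps {p,a} ↔ {p,b}, fixes {a,b} (inside) and {c,d} (outside)
    have hR : InvUnder (Equiv.swap a b) (Z₃ + Z₄) :=
      invUnder_add (invUnder_swap_of_mem hZ₃.1 (by simp) (by simp))
        (invUnder_swap_of_not_mem hZ₄.2 (by simp [hac, had]) (by simp [hbc, hbd]))
    have hs : SlotInvariantOn Finset.univ (Z₁ + Z₂ + (Z₃ + Z₄)) := by
      have e : Z₁ + Z₂ + (Z₃ + Z₄) = Z₁ + Z₂ + Z₃ + Z₄ := by abel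
      rw [e]; exact hsum
    exact exchange c₁ c₂ n12 (Equiv.swap a b) (image_pair_swap p a b hpa hpb)
      (by rw [Equiv.swap_comm]; exact image_pair_swap p b a hpb hpa) hZ₁ hZ₂ hR hs
  · -- τ = (p b): swaps {p,a} = {a,p} ↔ {a,b}, fixes {p,b} (inside) and {c,d} (outside)
    have hR : InvUnder (Equiv.swap p b) (Z₂ + Z₄) :=
      invUnder_add (invUnder_swap_of_mem hZ₂.1 (by simp) (by simp))
        (invUnder_swap_of_not_mem hZ₄.2 (by simp [hpc, hpd]) (by simp [hbc, hbd]))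
    have hs : SlotInvariantOn Finset.univ (Z₁ + Z₃ + (Z₂ + Z₄)) := by
      have e : Z₁ + Z₃ + (Z₂ + Z₄) = Z₁ + Z₂ + Z₃ + Z₄ := by abel
      rw [e]; exact hsum
    have i1 : ({p, a} : Finset (Fin 5)).image ⇑(Equiv.swap p b) = {a, b} := by
      rw [Finset.pair_comm p a, image_pair_swap a p b hpa.symm hab]
    have i3 : ({a, b} : Finset (Fin 5)).image ⇑(Equiv.swap p b) = {p, a} := by
      rw [Equiv.swap_comm, image_pair_swap a b p hab hpa.symm, Finset.pair_comm]
    exact exchange c₁ c₃ n13 (Equiv.swap p b) i1 i3 hZ₁ hZ₃ hR hs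

/-! ### §5 Antipodal coherence on the four-cycle -/

/-- **FOUR-CYCLE ANTIPODAL COHERENCE.**  On `C₄ = {01, 12, 23, 30}` the shadows of OPPOSITE edges are conjugate modulo fully
symmetric tensors: `Z₃ − ((0 3)(1 2))•Z₁` and `Z₄ − ((0 1)(2 3))•Z₂` are fully symmetric — the double transpositions exchange
opposite edges and lie in the Young groups of the two other edges.  (The ADJACENT relation — `Z₁ + (0 2)•Z₂` fully symmetric,
the alternating sign of the `(4,1)`-relation of `…FourSplitSlack.cycle_slack` — is NOT claimed here; with it the slack of `C₄`
is one `(4,1)`-vector, census `4 / 224`.) -/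
theorem cycle_antipodal_coherence (Z₁ Z₂ Z₃ Z₄ : (Fin 5 → Fin 5) → ℂ)
    (hZ₁ : SlotInvariantOn ({0, 1} : Finset (Fin 5)) Z₁ ∧ SlotInvariantOn ({0, 1} : Finset (Fin 5))ᶜ Z₁)
    (hZ₂ : SlotInvariantOn ({1, 2} : Finset (Fin 5)) Z₂ ∧ SlotInvariantOn ({1, 2} : Finset (Fin 5))ᶜ Z₂)
    (hZ₃ : SlotInvariantOn ({2, 3} : Finset (Fin 5)) Z₃ ∧ SlotInvariantOn ({2, 3} : Finset (Fin 5))ᶜ Z₃)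
    (hZ₄ : SlotInvariantOn ({3, 0} : Finset (Fin 5)) Z₄ ∧ SlotInvariantOn ({3, 0} : Finset (Fin 5))ᶜ Z₄)
    (hsum : SlotInvariantOn Finset.univ (Z₁ + Z₂ + Z₃ + Z₄)) :
    SlotInvariantOn Finset.univ (Z₃ - fun v => Z₁ (v ∘ ⇑(Equiv.swap (0 : Fin 5) 3 * Equiv.swap (1 : Fin 5) 2))) ∧
    SlotInvariantOn Finset.univ (Z₄ - fun v => Z₂ (v ∘ ⇑(Equiv.swap (0 : Fin 5) 1 * Equiv.swap (2 : Fin 5) 3))) := by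
  constructor
  · have hR : InvUnder (Equiv.swap (0 : Fin 5) 3 * Equiv.swap (1 : Fin 5) 2) (Z₂ + Z₄) :=
      invUnder_add
        (invUnder_mul (invUnder_swap_of_not_mem hZ₂.2 (by decide) (by decide))
          (invUnder_swap_of_mem hZ₂.1 (by simp) (by simp)))
        (invUnder_mul (invUnder_swap_of_mem hZ₄.1 (by simp) (by simp))
          (invUnder_swap_of_not_mem hZ₄.2 (by decide) (by decide)))
    have hs : SlotInvariantOn Finset.univ (Z₁ + Z₃ + (Z₂ + Z₄)) := by
      have e : Z₁ + Z₃ + (Z₂ + Z₄) = Z₁ + Z₂ + Z₃ + Z₄ := by abel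
      rw [e]; exact hsum
    exact exchange (by decide) (by decide) (by decide) (Equiv.swap (0 : Fin 5) 3 * Equiv.swap (1 : Fin 5) 2)
      (by decide) (by decide) hZ₁ hZ₃ hR hs
  · have hR : InvUnder (Equiv.swap (0 : Fin 5) 1 * Equiv.swap (2 : Fin 5) 3) (Z₁ + Z₃) :=
      invUnder_add
        (invUnder_mul (invUnder_swap_of_mem hZ₁.1 (by simp) (by simp))
          (invUnder_swap_of_not_mem hZ₁.2 (by decide) (by decide)))
        (invUnder_mul (invUnder_swap_of_not_mem hZ₃.2 (by decide) (by decide))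
          (invUnder_swap_of_mem hZ₃.1 (by simp) (by simp)))
    have hs : SlotInvariantOn Finset.univ (Z₂ + Z₄ + (Z₁ + Z₃)) := by
      have e : Z₂ + Z₄ + (Z₁ + Z₃) = Z₁ + Z₂ + Z₃ + Z₄ := by abel
      rw [e]; exact hsum
    exact exchange (by decide) (by decide) (by decide) (Equiv.swap (0 : Fin 5) 1 * Equiv.swap (2 : Fin 5) 3)
      (by decide) (by decide) hZ₂ hZ₄ hR hs


end LaplaceFiveSectorSplit

end Summit.ValiantsHypothesis.ValiantsHypothesis.Theorems.RigidityForcesSymmetryRankRigidMinimalRepr
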